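import Mathlib.GroupTheory.FreeGroup.CyclicallyReduced
import Literature.IUT.HodgeTheaters.TemperedCoveringsCor23LevelsSub
import Literature.IUT.HodgeTheaters.TemperedCoveringsFreeModel
import HarnessLib

/-!
# Non-vacuity of the [IUTchI] Prop. 2.4 level structures `Prop24Tower.SubgraphLevelData` and `Prop24QTower`

Mochizuki, *Inter-universal Teichmüller theory I*, kurims manuscript (May 2020), §2, Proposition 2.4,
pp. 50–51 ([IUTchI] Prop 2.4 pp.50-51) [claim: Mochizuki2012, status: disputed] (D-0012 claim key; nothing
of the series is asserted here).

PROOF-ONLY non-vacuity file (abc-iut cell, NV-L5 row family of abc-iut-L5-lead RULINGS #27, rows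
`Prop24Tower.SubgraphLevelData` and `StableCurveTemperedData.Prop24QTower`, seat abc-iut-w4-d063; the row
`Prop24Tower` itself is abc-iut-w4-d012's).  No definition: every witness is built inside a theorem.  HONEST
LABELS (cell rule): `_model` = the genuine object of the toy datum `StableCurveTemperedData.FreeModel.toy`
(abc-iut-L5-d4: `Π^tp_𝔾 = F₂ = π₁` of the bouquet `B₂` on the loops `x₀, x₁`, densely and injectively embedded
in `Π̂_𝔾 = F̂₂`; curve level = graph level, `G_k = 1`, no cusps; sub-semi-graph `ℍ` = the `x₀`-loop,
`Π^tp_ℍ = ⟨x₀⟩`); `_degenerate` = a one-point / identity inhabitant recording ONLY that the type is inhabited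
(never to be cited for non-vacuity of the laws).

* § 1 `_degenerate`, over EVERY datum `D` / EVERY tower `T`: `Prop24QTower.nonempty_degenerate` (every level
  quotient is `Π^tp_X ↪ Π̂_X` itself: the quotient by the trivial kernel) and
  `Prop24Tower.SubgraphLevelData.nonempty_degenerate` (one-vertex level graphs).
* § 2 `_model` on the GRAPH axis, `SubgraphLevelData` over ANY tower `T` of the toy with normal levels
  (`T.LevelsNormal` — "characteristic", p. 50 l. 27; e.g. abc-iut-w4-d012's tower of all finite-index normal
  subgroups of `F₂`): at the level `J_i ⊴ F₂` the finite étale covering of the bouquet has vertex set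
  `F₂ ⧸ J_i`, `Π^tp_X = F₂` acting by left translation; the inverse image of `ℍ` is the `x₀`-Schreier
  subgraph, whose connected components are the classes `{g·x₀^k·J_i}_k`, `ℍ̃_i` being the class of the base
  vertex.  PROVED for this data: B4 `CompsDisjoint`, `CompsInvariant`, `IsBlock`; B1 `LevelActsTrivially`,
  `DeltaHStabilizes`, `StabLeDeltaHLevel` (`Stab_{F₂}(ℍ̃_i) = ⟨x₀⟩·J_i`); the cusp-indexed rows `LevelIncidence` /
  `LevelTarget` hold VACUOUSLY (the toy has no cusps) — `SubgraphLevelData.exists_model_free`.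
* § 3 `_model` on the tempered/profinite axis, LEVEL-CONSTANT, `Prop24QTower` at the toy: since curve level =
  graph level, `Ker(J ↠ Π^tp_{𝔾*_J}) = 1` and every level quotient is `F₂ ↪ F̂₂` itself; `LevelObservation`
  holds VACUOUSLY (a compact subgroup of the discrete torsion-free `F₂` is trivial: there is no `Λ` to test)
  and `QDetectsTempered` tautologically, so `prop24ii_of_qtower` is instantiated (`Prop24QTower.exists_model_free`,
  `prop24ii`) — at a datum where its content is empty, which the docstrings say.

What this file is NOT: not a `_model` over the L3 producers (BLOCKED-UPSTREAM: an honest multi-level tower needs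
the special-fibre datum of EVERY characteristic open subgroup of `Δ^tp_X`, which no file supplies), and not the
arithmetic situation of p. 50 (no curve).  Nothing here bears on [IUTchIII] Cor. 3.12; instantiated ≠ endorsed.
-/

namespace Literature.IUT.HodgeTheaters

namespace StableCurveTemperedData

open scoped Pointwise

universe u

/-! ### § 1. `_degenerate` inhabitants over every datum (type-inhabitation only) -/

/-- **`Prop24QTower` is inhabited over EVERY datum `D`** by the `_degenerate` one-level tower whose level
quotient is `Π^tp_X ↪ Π̂_X` itself (quotient by the trivial kernel; `qtp`, `qhat` the identities).  DEGENERATE: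
records only that the type is inhabited; at this tower `QDetectsTempered` is tautological and `LevelObservation`
is the arithmetic Prop. 2.1 for `Π^tp_X ↪ Π̂_X`, i.e. essentially Prop. 2.4 (ii) itself — useless for a
discharge, and not evidence that the printed quotient tower exists.
([IUTchI] Prop 2.4(ii) p.50) [claim: Mochizuki2012, status: disputed] -/
theorem Prop24QTower.nonempty_degenerate (D : StableCurveTemperedData.{u}) : Nonempty D.Prop24QTower :=
  ⟨{ I := PUnit
     Q := fun _ =>
      { Sigma := D.graph.Sigma
        SigmaHat := D.graph.SigmaHat
        sigma_subset := D.graph.sigma_subset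
        sigma_nonempty := D.graph.sigma_nonempty
        sigmaHat_prime := D.graph.sigmaHat_prime
        Tp := D.PiTp
        Hat := D.PiHat
        ι := D.ιX
        ι_continuous := D.ιX_continuous
        ι_injective := D.ιX_injective
        TpH := ⊤
        HatH := ⊤
        tpH_le := le_top }
     qtp := fun _ => MonoidHom.id D.PiTp
     qhat := fun _ => MonoidHom.id D.PiHat
     hq := fun _ _ => rfl }⟩

/-- **`Prop24Tower.SubgraphLevelData` is inhabited over EVERY tower `T` of every datum** by the `_degenerate`
one-vertex level graphs (one component, trivial action).  DEGENERATE: type-inhabitation only.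
([IUTchI] Prop 2.4(i) p.50) [claim: Mochizuki2012, status: disputed] -/
theorem Prop24Tower.SubgraphLevelData.nonempty_degenerate {D : StableCurveTemperedData.{u}}
    (T : D.Prop24Tower) : Nonempty T.SubgraphLevelData :=
  ⟨{ Vtx := fun _ => PUnit
     act := fun _ => 1
     comps := fun _ => {Set.univ}
     compH := fun _ => Set.univ
     compH_mem := fun _ => rfl
     vtxCusp := fun _ _ => PUnit.unit }⟩

/-! ### § 2. The `_model` level subgraph data at the toy: Schreier cosets of the bouquet -/

namespace FreeModel

/-- In the toy, `Δ^tp_X = Ker(F₂ → 1)` is everything. [claim: Mochizuki2012, status: disputed] -/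
theorem mem_deltaTp (g : F2) : g ∈ toy.DeltaTp := by
  change g ∈ (1 : F2 →* Gk).ker
  rw [MonoidHom.mem_ker, MonoidHom.one_apply]

/-- In the toy, `Δ̂_X = Ker(F̂₂ → 1)` is everything. [claim: Mochizuki2012, status: disputed] -/
theorem mem_deltaHat (g : Hat) : g ∈ toy.DeltaHat := by
  change g ∈ (1 : Hat →* Gk).ker
  rw [MonoidHom.mem_ker, MonoidHom.one_apply]

/-- Membership in the toy's `Δ^tp_{X,ℍ} = ⟨x₀⟩`: an element of `Δ^tp_X = F₂` lies in `Δ^tp_{X,ℍ}` iff it lies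
in the subgroup generated by `x₀`. [claim: Mochizuki2012, status: disputed] -/
theorem mem_deltaTpH_iff (d : toy.DeltaTp) : d ∈ toy.deltaTpH ↔ (d : F2) ∈ Subgroup.zpowers x0 := by
  change toy.ρTp d ∈ TpH ↔ _
  rw [TpH, Subgroup.zpowers_eq_closure]
  rfl

/-- A level `Ĵ ⊆ F̂₂` normal in `Δ̂_X = F̂₂` pulls back to a NORMAL subgroup `J = ι⁻¹(Ĵ)` of `F₂`.
[claim: Mochizuki2012, status: disputed] -/
theorem comap_normal_of_levelsNormal (T : toy.Prop24Tower) (hN : T.LevelsNormal) (i : T.I) :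
    ((T.Jhat i).comap toy.ιX).Normal := by
  have hJ : (T.Jhat i).Normal := by
    refine ⟨fun h hh k => ?_⟩
    have := (hN i).conj_mem ⟨h, mem_deltaHat h⟩ (Subgroup.mem_subgroupOf.mpr hh) ⟨k, mem_deltaHat k⟩
    exact Subgroup.mem_subgroupOf.mp this
  exact hJ.comap _

/-- The Schreier classes `{g·x₀^k·J}_k ⊆ F₂ ⧸ J` of the `x₀`-loop: two classes that MEET coincide (for `J`
normal in `F₂`) — here one inclusion, from one common vertex. [claim: Mochizuki2012, status: disputed] -/
theorem schreierClass_subset_of_eq (J : Subgroup F2) (hJ : J.Normal) (g h : F2) (k m : ℤ)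
    (hgh : ((g * x0 ^ k : F2) : F2 ⧸ J) = ((h * x0 ^ m : F2) : F2 ⧸ J)) :
    Set.range (fun n : ℤ => ((h * x0 ^ n : F2) : F2 ⧸ J)) ⊆
      Set.range (fun n : ℤ => ((g * x0 ^ n : F2) : F2 ⧸ J)) := by
  rintro _ ⟨n, rfl⟩
  have hj : (g * x0 ^ k)⁻¹ * (h * x0 ^ m) ∈ J := QuotientGroup.eq.mp hgh
  refine ⟨k + (n - m), QuotientGroup.eq.mpr ?_⟩
  have : (g * x0 ^ (k + (n - m)))⁻¹ * (h * x0 ^ n) =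
      (x0 ^ (n - m))⁻¹ * ((g * x0 ^ k)⁻¹ * (h * x0 ^ m)) * x0 ^ (n - m) := by
    group
  rw [this]
  exact hJ.conj_mem' _ hj _

/-- Left translation by `t ∈ F₂` carries the Schreier class of `g` to that of `t·g`.
[claim: Mochizuki2012, status: disputed] -/
theorem smul_image_schreierClass (J : Subgroup F2) (t g : F2) :
    (fun v : F2 ⧸ J => t • v) '' Set.range (fun n : ℤ => ((g * x0 ^ n : F2) : F2 ⧸ J)) =
      Set.range (fun n : ℤ => ((t * g * x0 ^ n : F2) : F2 ⧸ J)) := by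
  rw [← Set.range_comp]
  congr 1
  funext n
  change t • ((g * x0 ^ n : F2) : F2 ⧸ J) = _
  rw [MulAction.Quotient.smul_mk, smul_eq_mul, mul_assoc]

/-- **NV-L5 `Prop24Tower.SubgraphLevelData`, `_model` on the graph axis at the toy.**  For ANY tower `T` of the
toy datum with normal levels, the Schreier-coset level data — level-`i` vertices `F₂ ⧸ J_i`, `J_i := ι⁻¹(Ĵ_i)`
(the vertices of the finite étale covering of the bouquet `B₂` determined by `J_i`), `Π^tp_X = F₂` acting by left
translation, components of the inverse image of the `x₀`-loop `ℍ` = the Schreier classes `{g·x₀^k·J_i}_k`, `ℍ̃_i` =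
the class of the base vertex, no cusps — satisfies B4 (`CompsDisjoint`, `CompsInvariant`, `IsBlock`), B1
(`LevelActsTrivially`, `DeltaHStabilizes`, `StabLeDeltaHLevel`: the stabiliser of `ℍ̃_i` in `F₂` is `⟨x₀⟩·J_i`)
and, VACUOUSLY (no cusps), `LevelIncidence` and `LevelTarget`.
([IUTchI] Prop 2.4(i) p.50) [claim: Mochizuki2012, status: disputed] -/
theorem SubgraphLevelData.exists_model_free (T : toy.Prop24Tower) (hN : T.LevelsNormal) :
    ∃ L : T.SubgraphLevelData,
      (∀ i, L.Vtx i = (F2 ⧸ (T.Jhat i).comap toy.ιX)) ∧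
      L.CompsDisjoint ∧ L.CompsInvariant ∧ L.IsBlock ∧ L.LevelActsTrivially ∧ L.DeltaHStabilizes ∧
        L.StabLeDeltaHLevel ∧ L.LevelIncidence ∧ T.LevelTarget := by
  classical
  have hJn : ∀ i, ((T.Jhat i).comap toy.ιX).Normal := comap_normal_of_levelsNormal T hN
  let L : T.SubgraphLevelData :=
    { Vtx := fun i => F2 ⧸ (T.Jhat i).comap toy.ιX
      act := fun i => MulAction.toPermHom F2 (F2 ⧸ (T.Jhat i).comap toy.ιX)
      comps := fun i => Set.range fun g : F2 =>
        Set.range fun k : ℤ => ((g * x0 ^ k : F2) : F2 ⧸ (T.Jhat i).comap toy.ιX)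
      compH := fun i => Set.range fun k : ℤ => ((x0 ^ k : F2) : F2 ⧸ (T.Jhat i).comap toy.ιX)
      compH_mem := fun i => ⟨1, by simp only [one_mul]⟩
      vtxCusp := fun _ x => nomatch x }
  have hdisj : L.CompsDisjoint := by
    intro i A hA B hB hAB
    obtain ⟨g, rfl⟩ : ∃ g : F2,
        (Set.range fun k : ℤ => ((g * x0 ^ k : F2) : F2 ⧸ (T.Jhat i).comap toy.ιX)) = A := hA
    obtain ⟨h, rfl⟩ : ∃ h : F2,
        (Set.range fun k : ℤ => ((h * x0 ^ k : F2) : F2 ⧸ (T.Jhat i).comap toy.ιX)) = B := hB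
    obtain ⟨v, ⟨k, rfl⟩, ⟨m, hm⟩⟩ := hAB
    exact Set.Subset.antisymm (schreierClass_subset_of_eq _ (hJn i) h g m k hm)
      (schreierClass_subset_of_eq _ (hJn i) g h k m hm.symm)
  have hinv : L.CompsInvariant := by
    intro i t A hA
    obtain ⟨g, rfl⟩ : ∃ g : F2,
        (Set.range fun k : ℤ => ((g * x0 ^ k : F2) : F2 ⧸ (T.Jhat i).comap toy.ιX)) = A := hA
    refine ⟨t * g, ?_⟩
    change _ = (fun v : F2 ⧸ (T.Jhat i).comap toy.ιX => t • v) '' _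
    rw [smul_image_schreierClass]
  refine ⟨L, fun _ => rfl, hdisj, hinv, L.isBlock_of_comps hdisj hinv, ?_, ?_, ?_, ?_, ?_⟩
  · -- B1 (a) LevelActsTrivially: `J_i` acts trivially on `F₂ ⧸ J_i` (normality of `J_i`)
    intro i j hj
    ext v
    induction v using QuotientGroup.induction_on with
    | H g =>
      change ((j : F2) • (g : F2 ⧸ (T.Jhat i).comap toy.ιX)) = (g : F2 ⧸ (T.Jhat i).comap toy.ιX)
      rw [MulAction.Quotient.smul_mk, smul_eq_mul, QuotientGroup.eq, mul_inv_rev]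
      exact (hJn i).conj_mem' _ (inv_mem hj) g
  · -- B1 (b) DeltaHStabilizes: `⟨x₀⟩` stabilises the class of the base vertex
    intro i k hk v hv
    obtain ⟨m, hm⟩ := Subgroup.mem_zpowers_iff.mp ((mem_deltaTpH_iff k).mp hk)
    obtain ⟨n, rfl⟩ : ∃ n : ℤ, ((x0 ^ n : F2) : F2 ⧸ (T.Jhat i).comap toy.ιX) = v := hv
    refine ⟨m + n, ?_⟩
    change ((x0 ^ (m + n) : F2) : F2 ⧸ (T.Jhat i).comap toy.ιX) =
      (k : F2) • ((x0 ^ n : F2) : F2 ⧸ (T.Jhat i).comap toy.ιX)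
    rw [MulAction.Quotient.smul_mk, smul_eq_mul, ← hm, zpow_add]
  · -- B1 (c) StabLeDeltaHLevel: the stabiliser of `ℍ̃_i` lies in `⟨x₀⟩·J_i`
    intro i γ hγ
    have h1 : ((x0 ^ (0 : ℤ) : F2) : F2 ⧸ (T.Jhat i).comap toy.ιX) ∈ L.compH i := ⟨0, rfl⟩
    obtain ⟨m, hm⟩ : ∃ m : ℤ, ((x0 ^ m : F2) : F2 ⧸ (T.Jhat i).comap toy.ιX) =
        (γ : F2) • ((x0 ^ (0 : ℤ) : F2) : F2 ⧸ (T.Jhat i).comap toy.ιX) := hγ _ h1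
    rw [MulAction.Quotient.smul_mk, smul_eq_mul, zpow_zero, mul_one, QuotientGroup.eq] at hm
    refine ⟨⟨x0 ^ m, mem_deltaTp _⟩, (mem_deltaTpH_iff _).mpr ⟨m, rfl⟩, ?_⟩
    exact hm
  · -- LevelIncidence: no cusps
    intro i x
    exact nomatch x
  · -- LevelTarget: no cusps
    intro i x
    exact nomatch x

/-! ### § 3. The level-constant quotient tower at the toy and Prop. 2.4 (ii) there -/

/-- The toy's `Π^tp_X = F₂` (discrete, torsion-free) has NO nontrivial compact subgroup: a compact subset of a
discrete space is finite, and a finite subgroup of a torsion-free group is trivial.  (This is why every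
`Λ`-quantified clause of Prop. 2.4 holds VACUOUSLY at the toy.) [claim: Mochizuki2012, status: disputed] -/
theorem eq_bot_of_isCompact (Λ : Subgroup F2) (hΛ : IsCompact (Λ : Set F2)) : Λ = ⊥ := by
  haveI : IsMulTorsionFree F2 := inferInstanceAs (IsMulTorsionFree (FreeGroup (Fin 2)))
  haveI : Finite Λ := (hΛ.finite_of_discrete).to_subtype
  refine (Subgroup.eq_bot_iff_forall _).mpr fun l hl => ?_
  by_contra hl1
  have hfin : IsOfFinOrder (⟨l, hl⟩ : Λ) := isOfFinOrder_of_finite _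
  exact not_isOfFinOrder_of_isMulTorsionFree hl1 (Λ.subtype.isOfFinOrder hfin)

/-- **NV-L5 `Prop24QTower`, `_model` on the tempered/profinite axis at the toy, LEVEL-CONSTANT.**  At the toy
(curve level = graph level) the kernel `Ker(J ↠ Π^tp_{𝔾*_J})` is trivial for every level, so every level quotient
is `Π^tp_X ↪ Π̂_X` = `F₂ ↪ F̂₂` itself (one level suffices; `qtp`, `qhat` the identities); for this tower
`LevelObservation` (the arithmetic Prop. 2.1 per level) holds VACUOUSLY — `F₂` has no nontrivial compact subgroup
(`eq_bot_of_isCompact`) — and `QDetectsTempered` tautologically.  HONEST SCOPE: this certifies joint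
satisfiability of the data + the two laws of `prop24ii_of_qtower`, at a datum where their content is empty.
([IUTchI] Prop 2.4(ii) p.50) [claim: Mochizuki2012, status: disputed] -/
theorem Prop24QTower.exists_model_free :
    ∃ Tq : toy.Prop24QTower, (∀ j, Tq.Q j = toy.graph) ∧ Tq.LevelObservation ∧ Tq.QDetectsTempered := by
  refine ⟨{ I := PUnit
            Q := fun _ => toy.graph
            qtp := fun _ => MonoidHom.id F2
            qhat := fun _ => MonoidHom.id Hat
            hq := fun _ _ => rfl }, fun _ => rfl, ?_, ?_⟩
  · intro j Λ hΛc hΛne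
    exact absurd (eq_bot_of_isCompact Λ hΛc) hΛne
  · intro γ hγ
    exact hγ PUnit.unit

/-- **[IUTchI] Prop. 2.4 (ii) AS TYPED holds at the toy datum**, through abc-iut-w5-d119's `prop24ii_of_qtower`
at the level-constant tower — VACUOUS CONTENT (the toy has no nontrivial compact `Λ ⊆ Π^tp_X`); recorded as the
instantiation check of the (ii) binder package, not as evidence about the arithmetic statement.
([IUTchI] Prop 2.4(ii) p.50) [claim: Mochizuki2012, status: disputed] -/
theorem prop24ii : toy.Prop24ii := by
  obtain ⟨Tq, -, hLev, hINV⟩ := Prop24QTower.exists_model_free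
  exact Tq.prop24ii_of_qtower hLev hINV

end FreeModel

end StableCurveTemperedData

end Literature.IUT.HodgeTheaters
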